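import Mathlib
import Literature.AlgebraicGeometry.Resolution.CobordantGame
import Literature.AlgebraicGeometry.Resolution.CobordantChartCoefficients
import Literature.AlgebraicGeometry.Resolution.CobordantTupleGame
import Literature.AlgebraicGeometry.Resolution.FormalCoordinateChange
import Summits.ResolutionOfSingularities.ResolutionOfSingularities.Theorems.WeightedInvariantLocalWeightedDropWildTerminalCalculus
import Summits.ResolutionOfSingularities.ResolutionOfSingularities.Theorems.WeightedInvariantLocalWeightedDropWildTerminalApex

/-!
# `WeightedInvariant.LocalWeightedDrop`, line `hasse-ridge-face-selection`: the SUCCESSOR STEP for the terminal purely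
# inseparable surface forms (the `good` dichotomy of `monicFormsWon_of_rankOn` on the terminal class, and the successor
# coefficients after the curve and point blow-ups)

Crux item stmt-ResolutionOfSingularities-8899 `LocalWeightedDrop` (route `ResolutionOfSingularities/WeightedInvariant`),
serving the door `WeightedConstruction` stmt-ResolutionOfSingularities-0571.  [OURS · L1 W4.3, chain w43, stub worker 1
(gen 2): helpers for the candidate piece S3πT `stub_wildPurelyInseparableTerminalWon` of the S3 cut, proved in
`…WildTerminalWon`.  Not a statement of any manuscript.]

* `good_intro`: a slice `S = y^d + T(x')` with `ord T < ord A₀`, where `ord T < d` or `T` is TERMINAL (monomial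
  `x₁^r x₂^s U`, `(r,s) ∉ dℕ²`, or small residual `x_i^{dm} g`, `0 < ord g < d`), is an EXIT (order `< d`, or order `d`
  with the apex-free binomial cone) or a terminal POSITION `(T, 0, …, 0)` of smaller rank `ord T` — literally the `good`
  disjunction of `monicFormsWon_of_rankOn` for the class of terminal tuples, exits «order drop ∨ apex-free», rank `ord A₀`;
* the successor coefficients: `curveCoeff_monomial` / `curveCoeff_residual` (curve blow-up `V(x_i, y)`: the slice of the
  axis-chart transform of `x_i^n x_j^t U`, resp. `x_i^n g`), `order_curveResidual`, `X_mul_pointBv` (the saturated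
  point-blow-up transform of `x₁^r x₂^s U`), and the vanishing of all other coefficients of the collapsed tuple
  (`curveCoeff_vanish`, `pointCoeff_vanish`).
-/

set_option linter.dupNamespace false -- mandated namespace of this single-conjunct summit

namespace Summit.ResolutionOfSingularities.ResolutionOfSingularities.Theorems

open Literature.AlgebraicGeometry.Resolution
open Literature.AlgebraicGeometry.Resolution.CobordantGame

namespace WildTerminal

open MvPowerSeries

variable {k : Type} [Field k]

/-- The collapsed tuple `(T, 0, …, 0)`. -/
theorem tuple_apply_zero {d : ℕ} (hd : 0 < d) (T : MvPowerSeries (Fin 2) k) :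
    (fun j : Fin d => if (j : ℕ) = 0 then T else 0) ⟨0, hd⟩ = T := by
  simp

/-- The collapsed tuple vanishes off `j = 0`. -/
theorem tuple_apply_ne {d : ℕ} (T : MvPowerSeries (Fin 2) k) (j : Fin d) (hj : (j : ℕ) ≠ 0) :
    (fun j : Fin d => if (j : ℕ) = 0 then T else 0) j = 0 := by
  simp [hj]

/-- In the monomial case `a + b = d`, `(a, b) ∉ dℕ²` forces `a, b ≥ 1`. -/
theorem pos_of_not_dvd {a b d : ℕ} (hab : a + b = d) (h : ¬ (d ∣ a ∧ d ∣ b)) : 0 < a ∧ 0 < b := by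
  by_contra hc
  apply h
  rcases Nat.eq_zero_or_pos a with ha | ha
  · subst ha
    simp at hab
    subst hab
    exact ⟨dvd_zero _, dvd_rfl⟩
  · rcases Nat.eq_zero_or_pos b with hb | hb
    · subst hb
      simp at hab
      subst hab
      exact ⟨dvd_rfl, dvd_zero _⟩
    · exact absurd ⟨ha, hb⟩ hc

/-- THE SUCCESSOR DICHOTOMY (`good` of `monicFormsWon_of_rankOn` for the terminal class): a slice `S = y^d + T(x')` with
`ord T < ord A₀` is an exit (order `< d`, or the apex-free binomial cone when `ord T = d`) or a terminal position of
smaller rank — provided `ord T < d` or `T` is terminal. -/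
theorem good_intro {d : ℕ} (hd : 0 < d) (A : Fin d → MvPowerSeries (Fin 2) k) (hA0 : A ⟨0, hd⟩ ≠ 0)
    (T : MvPowerSeries (Fin 2) k) (S : MvPowerSeries (Fin (2 + 1)) k)
    (hS : S = X (Fin.last 2) ^ d + rename (Fin.succAboveEmb (Fin.last 2)) T)
    (hT : T.order < d ∨
      ((∃ (r s : ℕ) (U : MvPowerSeries (Fin 2) k), constantCoeff U ≠ 0 ∧ ¬ (d ∣ r ∧ d ∣ s) ∧
          T = X (0 : Fin 2) ^ r * X (1 : Fin 2) ^ s * U) ∨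
        (∃ (i : Fin 2) (m : ℕ) (g : MvPowerSeries (Fin 2) k), 0 < m ∧ 0 < g.order ∧ g.order < d ∧
          T = X i ^ (d * m) * g)))
    (hlt : T.order < (A ⟨0, hd⟩).order) :
    (S.order < d ∨ (S.order = d ∧ ∀ c : Fin (2 + 1) → k, c ≠ 0 → ∃ v : Fin (2 + 1) → k,
        CobordantChart.initEval (fun _ : Fin (2 + 1) => 1) (v + c) d S ≠
          CobordantChart.initEval (fun _ : Fin (2 + 1) => 1) v d S)) ∨
    (∃ (M : Matrix (Fin (2 + 1)) (Fin (2 + 1)) k) (H : MvPowerSeries (Fin (2 + 1)) k)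
        (A' : Fin d → MvPowerSeries (Fin 2) k),
      IsUnit M.det ∧ constantCoeff H ≠ 0 ∧
      ((∀ j : Fin d, (j : ℕ) ≠ 0 → A' j = 0) ∧
        ((∃ (r s : ℕ) (U : MvPowerSeries (Fin 2) k), constantCoeff U ≠ 0 ∧ ¬ (d ∣ r ∧ d ∣ s) ∧
            A' ⟨0, hd⟩ = X (0 : Fin 2) ^ r * X (1 : Fin 2) ^ s * U) ∨
          (∃ (i : Fin 2) (m : ℕ) (g : MvPowerSeries (Fin 2) k), 0 < m ∧ 0 < g.order ∧ g.order < d ∧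
            A' ⟨0, hd⟩ = X i ^ (d * m) * g))) ∧
      (∀ j : Fin d, ((d - (j : ℕ) : ℕ) : ℕ∞) < (A' j).order) ∧
      subst (FormalCoordChange.linSubst M) S =
        H * (X (Fin.last 2) ^ d + ∑ j : Fin d, rename (Fin.succAboveEmb (Fin.last 2)) (A' j) * X (Fin.last 2) ^ (j : ℕ)) ∧
      ((A' ⟨0, hd⟩).order.toNat : Ordinal.{0}) < ((A ⟨0, hd⟩).order.toNat : Ordinal.{0})) := by
  classical
  -- exits by order drop
  by_cases hlow : T.order < d
  · left; left
    rw [hS]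
    exact lt_of_le_of_lt (order_X_pow_add_rename_le hd T) hlow
  rw [not_lt] at hlow
  have hT' := hT.resolve_left (not_lt.mpr hlow)
  -- the rank comparison, in `ℕ`
  have hTne : T ≠ 0 := by
    rintro rfl
    rw [order_zero] at hlt
    exact absurd hlt (not_lt.mpr le_top)
  have hκ : (T.order.toNat : Ordinal.{0}) < ((A ⟨0, hd⟩).order.toNat : Ordinal.{0}) := by
    have hTfin : T.order ≠ ⊤ := by rwa [Ne, order_eq_top_iff]
    have hAfin : (A ⟨0, hd⟩).order ≠ ⊤ := by rwa [Ne, order_eq_top_iff]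
    obtain ⟨o₁, ho₁⟩ := ENat.ne_top_iff_exists.mp hTfin
    obtain ⟨o₂, ho₂⟩ := ENat.ne_top_iff_exists.mp hAfin
    rw [← ho₁, ← ho₂, ENat.toNat_coe, ENat.toNat_coe, Nat.cast_lt]
    rw [← ho₁, ← ho₂] at hlt
    exact_mod_cast hlt
  -- positions of larger order re-enter the class
  have hpos : (d : ℕ∞) < T.order →
      (S.order < d ∨ (S.order = d ∧ ∀ c : Fin (2 + 1) → k, c ≠ 0 → ∃ v : Fin (2 + 1) → k,
          CobordantChart.initEval (fun _ : Fin (2 + 1) => 1) (v + c) d S ≠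
            CobordantChart.initEval (fun _ : Fin (2 + 1) => 1) v d S)) ∨
      (∃ (M : Matrix (Fin (2 + 1)) (Fin (2 + 1)) k) (H : MvPowerSeries (Fin (2 + 1)) k)
          (A' : Fin d → MvPowerSeries (Fin 2) k),
        IsUnit M.det ∧ constantCoeff H ≠ 0 ∧
        ((∀ j : Fin d, (j : ℕ) ≠ 0 → A' j = 0) ∧
          ((∃ (r s : ℕ) (U : MvPowerSeries (Fin 2) k), constantCoeff U ≠ 0 ∧ ¬ (d ∣ r ∧ d ∣ s) ∧
              A' ⟨0, hd⟩ = X (0 : Fin 2) ^ r * X (1 : Fin 2) ^ s * U) ∨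
            (∃ (i : Fin 2) (m : ℕ) (g : MvPowerSeries (Fin 2) k), 0 < m ∧ 0 < g.order ∧ g.order < d ∧
              A' ⟨0, hd⟩ = X i ^ (d * m) * g))) ∧
        (∀ j : Fin d, ((d - (j : ℕ) : ℕ) : ℕ∞) < (A' j).order) ∧
        subst (FormalCoordChange.linSubst M) S =
          H * (X (Fin.last 2) ^ d + ∑ j : Fin d, rename (Fin.succAboveEmb (Fin.last 2)) (A' j) * X (Fin.last 2) ^ (j : ℕ)) ∧
        ((A' ⟨0, hd⟩).order.toNat : Ordinal.{0}) < ((A ⟨0, hd⟩).order.toNat : Ordinal.{0})) := by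
    intro hgt
    right
    refine ⟨1, 1, fun j : Fin d => if (j : ℕ) = 0 then T else 0, ?_, ?_, ⟨fun j hj => tuple_apply_ne T j hj, ?_⟩,
      ?_, ?_, ?_⟩
    · rw [Matrix.det_one]; exact isUnit_one
    · rw [map_one]; exact one_ne_zero
    · rw [tuple_apply_zero hd T]; exact hT'
    · exact polyhedron_of_vanish hd _ (fun j hj => tuple_apply_ne T j hj) (by rw [if_pos rfl]; exact hgt)
    · rw [FormalCoordChange.linSubst_one, subst_self, id_eq, one_mul,
        monicForm_eq_of_vanish hd _ (fun j hj => tuple_apply_ne T j hj), if_pos rfl, hS]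
    · rw [tuple_apply_zero hd T]; exact hκ
  rcases lt_or_eq_of_le hlow with hgt | heq
  · exact hpos hgt
  · -- `ord T = d`: only the monomial case `a + b = d` can occur, and its cone has trivial apex
    rcases hT' with ⟨a, b, U, hU, hndvd, hTeq⟩ | ⟨i, m, g, hm, hg0, hgd, hTeq⟩
    · have hab : a + b = d := by
        have h := order_monomialUnit a b hU
        rw [← hTeq, ← heq] at h
        exact_mod_cast h.symm
      obtain ⟨ha, hb⟩ := pos_of_not_dvd hab hndvd
      left; right
      refine ⟨?_, fun c hc => ?_⟩
      · rw [hS]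
        exact order_X_pow_add_rename_eq hd T heq.le
      · rw [hS, hTeq]
        exact exists_initEval_add_ne_of_monomialUnit hd ha hb hab hU c hc
    · -- a small residual form has order `≥ d + 1`
      exfalso
      have h := order_X_pow_mul i (d * m) g
      rw [← hTeq, ← heq] at h
      have hg1 : (1 : ℕ∞) ≤ g.order := Order.one_le_iff_pos.mpr hg0
      have : (d : ℕ∞) + 1 ≤ (d : ℕ∞) := by
        calc (d : ℕ∞) + 1 ≤ ((d * m : ℕ) : ℕ∞) + g.order := by
              refine add_le_add ?_ hg1
              exact_mod_cast Nat.le_mul_of_pos_right d hm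
          _ = d := h.symm
      exact absurd this (by
        rw [not_le]
        exact_mod_cast Nat.lt_succ_self d)

/-! ### The successor coefficient after the three kinds of moves -/

/-- The axis chart is a ring map: it kills `0`. -/
theorem subst_axisChart_zero (i : Fin 2) (ci : k) :
    subst (CobordantChart.chart (fun l : Fin 2 => if l = i then 1 else 0) (fun l : Fin 2 => if l = i then ci else 0))
      (0 : MvPowerSeries (Fin 2) k) = 0 := by
  rw [← coe_substAlgHom (hasSubst_axisChart i ci), map_zero]

/-- Off `j = 0` the successor coefficients of the collapsed tuple vanish (curve blow-up). -/
theorem curveCoeff_vanish {d : ℕ} (i : Fin 2) (ci : k) (T : MvPowerSeries (Fin 2) k) (j : Fin d) (hj : (j : ℕ) ≠ 0) :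
    C (ci ^ (d - (j : ℕ))) * TupleGame.slice i (subst (CobordantChart.chart (fun l : Fin 2 => if l = i then 1 else 0)
      (fun l : Fin 2 => if l = i then ci else 0)) ((fun j : Fin d => if (j : ℕ) = 0 then T else 0) j)) = 0 := by
  rw [tuple_apply_ne T j hj, subst_axisChart_zero, slice_zero, mul_zero]

/-- THE AXIS CHART AND SLICE ON THE OTHER VARIABLE: `(x_j^t · U) ∘ chart_i | = x₂'^t · U'` (`j ≠ i`; the other variable
becomes the new second variable). -/
theorem slice_subst_axisChart_Xother_pow_mul (i j : Fin 2) (hij : j ≠ i) (ci : k) (t : ℕ) (U : MvPowerSeries (Fin 2) k) :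
    TupleGame.slice i (subst (CobordantChart.chart (fun l : Fin 2 => if l = i then 1 else 0)
        (fun l : Fin 2 => if l = i then ci else 0)) ((X j : MvPowerSeries (Fin 2) k) ^ t * U)) =
      (X 1 : MvPowerSeries (Fin 2) k) ^ t * TupleGame.slice i (subst (CobordantChart.chart
        (fun l : Fin 2 => if l = i then 1 else 0) (fun l : Fin 2 => if l = i then ci else 0)) U) := by
  have hs := hasSubst_axisChart i ci
  rw [← coe_substAlgHom hs, map_mul, map_pow, coe_substAlgHom, subst_X hs, axisChart_other i j hij, slice_mul, slice_pow]
  congr 2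
  have hi : i = 0 ∨ i = 1 := by fin_cases i <;> simp
  rcases hi with rfl | rfl
  · have hj1 : j = 1 := by fin_cases j <;> simp_all
    subst hj1
    exact slice_zero_X_two
  · have hj0 : j = 0 := by fin_cases j <;> simp_all
    subst hj0
    exact slice_one_X_one

/-- THE SUCCESSOR COEFFICIENT OF THE CURVE BLOW-UP IN THE MONOMIAL CASE: `c · ((x_i^n x_j^t U) ∘ chart_i)| =
x₁'^n x₂'^t · V` with `V = c · c_i^n · U'` a unit. -/
theorem curveCoeff_monomial (i j : Fin 2) (hij : j ≠ i) (c₀ ci : k) (n t : ℕ) (U : MvPowerSeries (Fin 2) k) :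
    C c₀ * TupleGame.slice i (subst (CobordantChart.chart (fun l : Fin 2 => if l = i then 1 else 0)
        (fun l : Fin 2 => if l = i then ci else 0)) ((X i : MvPowerSeries (Fin 2) k) ^ n * (X j ^ t * U))) =
      (X 0 : MvPowerSeries (Fin 2) k) ^ n * X 1 ^ t * (C c₀ * C ci ^ n * TupleGame.slice i (subst (CobordantChart.chart
        (fun l : Fin 2 => if l = i then 1 else 0) (fun l : Fin 2 => if l = i then ci else 0)) U)) := by
  rw [slice_subst_axisChart_X_pow_mul, slice_subst_axisChart_Xother_pow_mul i j hij, mul_pow]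
  ring

/-- THE SUCCESSOR COEFFICIENT OF THE CURVE BLOW-UP IN THE SMALL RESIDUAL CASE: `c · ((x_i^n g) ∘ chart_i)| =
x₁'^n · (c · c_i^n · g')`. -/
theorem curveCoeff_residual (i : Fin 2) (c₀ ci : k) (n : ℕ) (g : MvPowerSeries (Fin 2) k) :
    C c₀ * TupleGame.slice i (subst (CobordantChart.chart (fun l : Fin 2 => if l = i then 1 else 0)
        (fun l : Fin 2 => if l = i then ci else 0)) ((X i : MvPowerSeries (Fin 2) k) ^ n * g)) =
      (X 0 : MvPowerSeries (Fin 2) k) ^ n * (C c₀ * C ci ^ n * TupleGame.slice i (subst (CobordantChart.chart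
        (fun l : Fin 2 => if l = i then 1 else 0) (fun l : Fin 2 => if l = i then ci else 0)) g)) := by
  rw [slice_subst_axisChart_X_pow_mul, mul_pow]
  ring

/-- THE SLICED TRANSFORM `g'' = c · c_i^n · (g ∘ chart_i)|` of a small residual factor: `0 < ord g'' < d`. -/
theorem order_curveResidual (i : Fin 2) {c₀ ci : k} (hc₀ : c₀ ≠ 0) (hci : ci ≠ 0) (n : ℕ) {d : ℕ}
    (g : MvPowerSeries (Fin 2) k) (hg0 : 0 < g.order) (hgd : g.order < d) :
    0 < (C c₀ * C ci ^ n * TupleGame.slice i (subst (CobordantChart.chart (fun l : Fin 2 => if l = i then 1 else 0)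
        (fun l : Fin 2 => if l = i then ci else 0)) g)).order ∧
    (C c₀ * C ci ^ n * TupleGame.slice i (subst (CobordantChart.chart (fun l : Fin 2 => if l = i then 1 else 0)
        (fun l : Fin 2 => if l = i then ci else 0)) g)).order < (d : ℕ∞) := by
  have hunit : constantCoeff (C c₀ * C ci ^ n : MvPowerSeries (Fin 2) k) ≠ 0 := by
    rw [map_mul, map_pow, constantCoeff_C, constantCoeff_C]
    exact mul_ne_zero hc₀ (pow_ne_zero n hci)
  rw [MvPowerSeries.order_mul, order_eq_zero_of_constantCoeff_ne_zero hunit, zero_add]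
  refine ⟨?_, order_slice_subst_axisChart_lt i hci g hgd⟩
  rw [Order.one_le_iff_pos.symm, one_le_order_iff_constCoeff_eq_zero, constantCoeff_slice_subst_axisChart]
  exact one_le_order_iff_constCoeff_eq_zero.mp (Order.one_le_iff_pos.mpr hg0)

/-- Off `j = 0` the successor coefficients of the collapsed tuple vanish (point blow-up: `B_j = 0` is forced). -/
theorem pointCoeff_vanish {d : ℕ} (c : Fin 2 → k) (i₀ : Fin 2) (A : Fin d → MvPowerSeries (Fin 2) k)
    (hvan : ∀ j : Fin d, (j : ℕ) ≠ 0 → A j = 0) (Bv : Fin d → MvPowerSeries (Fin (2 + 1)) k)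
    (hBv : ∀ j : Fin d, subst (CobordantChart.chart (fun _ : Fin 2 => 1) c) (A j) = X 0 ^ (d - (j : ℕ) + 1) * Bv j)
    (j : Fin d) (hj : (j : ℕ) ≠ 0) : TupleGame.slice i₀ (X 0 * Bv j) = 0 := by
  have h := hBv j
  rw [hvan j hj, ← coe_substAlgHom (hasSubst_pointChart c), map_zero] at h
  rw [eq_zero_of_X_pow_mul_eq_zero 0 _ h.symm, mul_zero, slice_zero]

/-- THE SATURATED POINT-BLOW-UP TRANSFORM OF A MONOMIAL COEFFICIENT: from `(x₁^r x₂^s U) ∘ chart(c) = s^{d+1} B₀` and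
`d < r + s`: `s · B₀ = s^{r+s-d} · (c₁+y₁)^r (c₂+y₂)^s · U∘chart(c)`. -/
theorem X_mul_pointBv {d r s : ℕ} (hd : 0 < d) (hrs : d < r + s) (c : Fin 2 → k) (U : MvPowerSeries (Fin 2) k)
    (B₀ : MvPowerSeries (Fin (2 + 1)) k)
    (hB : subst (CobordantChart.chart (fun _ : Fin 2 => 1) c) ((X 0 : MvPowerSeries (Fin 2) k) ^ r * X 1 ^ s * U) =
      X 0 ^ (d - ((⟨0, hd⟩ : Fin d) : ℕ) + 1) * B₀) :
    (X 0 : MvPowerSeries (Fin (2 + 1)) k) * B₀ = X 0 ^ (r + s - d) * ((C (c 0) + X 1) ^ r * (C (c 1) + X 2) ^ s *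
      subst (CobordantChart.chart (fun _ : Fin 2 => 1) c) U) := by
  rw [subst_pointChart_monomialUnit, show d - ((⟨0, hd⟩ : Fin d) : ℕ) + 1 = d + 1 by simp] at hB
  have hsplit : (X 0 : MvPowerSeries (Fin (2 + 1)) k) ^ (r + s) = X 0 ^ (d + 1) * X 0 ^ (r + s - (d + 1)) := by
    rw [← pow_add]; congr 1; omega
  rw [hsplit, mul_assoc] at hB
  have hB' := eq_of_X_pow_mul_eq 0 (d + 1) hB
  rw [← hB', ← mul_assoc, ← pow_succ']
  congr 2
  omega

/-- The constant coefficient of a unit slice `c · c_i^n · U'`. -/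
theorem constantCoeff_curveUnit (i : Fin 2) (c₀ ci : k) (n : ℕ) (U : MvPowerSeries (Fin 2) k) :
    constantCoeff (C c₀ * C ci ^ n * TupleGame.slice i (subst (CobordantChart.chart (fun l : Fin 2 => if l = i then 1 else 0)
        (fun l : Fin 2 => if l = i then ci else 0)) U)) = c₀ * ci ^ n * constantCoeff U := by
  rw [map_mul, map_mul, map_pow, constantCoeff_C, constantCoeff_C, constantCoeff_slice_subst_axisChart]

end WildTerminal

end Summit.ResolutionOfSingularities.ResolutionOfSingularities.Theorems
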